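import Mathlib
import Summits.Ventures.PercRepro2.Defs
import Summits.Ventures.PercRepro2.Independence
import Summits.Ventures.PercRepro2.Harris
import Summits.Ventures.PercRepro2.Graph
import Summits.Ventures.PercRepro2.Exploration
import Summits.Ventures.PercRepro2.Events
import Summits.Ventures.PercRepro2.Induced
import Summits.Ventures.PercRepro2.BoxUnionDefs
import Summits.Ventures.PercRepro2.BoxUnion
import Summits.Ventures.PercRepro2.BoxUnionPair
import Summits.Ventures.PercRepro2.PairTP2
import Summits.Ventures.PercRepro2.PairTP2Main
import Summits.Ventures.PercRepro2.SeparatedDefs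
import Summits.Ventures.PercRepro2.SeparatedPair
import Summits.Ventures.PercRepro2.PairTP2BroomLemmas
import Summits.Ventures.PercRepro2.PairTP2Broom
import Summits.Ventures.PercRepro2.PairTP2BroomGrid
import Summits.Ventures.PercRepro2.PairTP2BroomMass

/-!
# (PAIR-TP2), the (⟹) direction — part 4: extracting the broom, and the equivalence
(blind cell PercRepro2, mine-1 g39; proofs/MINE1-PAIRTP2.md §2′ without walks)

Two minimality arguments replace the path surgery of the paper proof: a linking configuration
with the fewest open edges has exactly ONE open edge at each terminal (`exists_unique_edge_at`:
any other open edge at `s` could be closed — the cluster of `t` does not see it, and `s ↔ u`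
survives through the first one by the bridge lemma and cluster surgery); an off-terminal
interface with the fewest open edges has an edge without which `u ↮ v` (`exists_interface`).
Hence every linkable and interfaced pair carries a broom (`exists_broom`), and with
`Broom.not_lsm`: there is an admissible weight vector at which the two-vertex status law is not
log-supermodular (`exists_not_lsm`). Together with the kernel (⟸)
(`PairTP2.pairLaw_lsm_of_not_linkable_or_not_interfaced`): **(PAIR-TP2) both ways in the kernel**
(`pairTP2_iff`).
-/

namespace Summit.Ventures.PercRepro2

namespace PairTP2Broom

open Finset
open scoped Classical

variable {V : Type*} {E : Type*} {ends : E → Sym2 V}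

variable [DecidableEq E] {s t u v : V}

namespace Broom

/-! ### Extracting the broom by minimality -/


section Exists

variable [Fintype E]

/-- **A minimal linking configuration has exactly one open edge at `s`**: any other open edge
at `s` could be closed — `t ↔ v` does not see it, and `s ↔ u` survives through the first one
(bridge lemma + cluster surgery). -/
lemma exists_unique_edge_at (ω₀ : Config E) (hst : ¬ Conn ends ω₀ s t) (hsu : Conn ends ω₀ s u)
    (htv : Conn ends ω₀ t v)
    (hmin : ∀ ω, ¬ Conn ends ω s t → Conn ends ω s u → Conn ends ω t v →
      openCount ω₀ ≤ openCount ω)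
    (hus : u ≠ s) :
    ∃ f, ω₀ f = true ∧ s ∈ ends f ∧ ∀ e, ω₀ e = true → s ∈ ends e → e = f := by
  obtain ⟨f, hf, hsf⟩ := exists_open_edge_at hus.symm hsu
  refine ⟨f, hf, hsf, ?_⟩
  intro e he hse
  by_contra hef
  have hts : ¬ Conn ends ω₀ t s := fun h => hst (conn_symm h)
  -- `ω'`: every open edge at `s` other than `f` closed
  set ω' : Config E := fun e' => if e' ≠ f ∧ s ∈ ends e' then false else ω₀ e' with hω'
  have hle : ∀ e', ω' e' = true → ω₀ e' = true := by
    intro e' h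
    by_cases h' : e' ≠ f ∧ s ∈ ends e'
    · simp only [hω', if_pos h'] at h
      exact absurd h Bool.false_ne_true
    · simpa only [hω', if_neg h'] using h
  -- `t ↔ v` in `ω'`
  have hC : cluster ends ω' t = cluster ends ω₀ t := by
    refine cluster_eq_of_eqOn_touches (fun e' he' => ?_) rfl
    by_cases h0 : ω₀ e' = true
    · by_cases h' : e' ≠ f ∧ s ∈ ends e'
      · exact absurd he' (not_touches_cluster_of_open_at hts h0 h'.2)
      · simp only [hω', if_neg h']
    · have h0' : ω₀ e' = false := by simpa using h0
      simp only [hω', h0', ite_self]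
  have htv' : Conn ends ω' t v := by
    have : v ∈ cluster ends ω' t := by
      rw [hC]
      exact htv
    exact this
  -- `s ↮ u` without `f` (else `ω₀ − f` is a smaller linking configuration)
  obtain ⟨a, hfa⟩ : ∃ a, ends f = s(s, a) := ⟨_, (Sym2.other_spec hsf).symm⟩
  have hsu_f : ¬ Conn ends (Function.update ω₀ f false) s u := by
    intro h
    have htv_f : Conn ends (Function.update ω₀ f false) t v := by
      have hC' := cluster_update_false_of_not_touches (ends := ends) (ω := ω₀) (v := t)
        (not_touches_cluster_of_open_at hts hf hsf)
      have : v ∈ cluster ends (Function.update ω₀ f false) t := by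
        rw [hC']
        exact htv
      exact this
    have hst_f : ¬ Conn ends (Function.update ω₀ f false) s t :=
      fun h' => hst (conn_mono (config_le_of_imp (update_false_imp ω₀ f)) h')
    have h1 := hmin _ hst_f h htv_f
    have h2 := openCount_lt_of_le (update_false_imp ω₀ f) hf
      (by rw [Function.update_self] : Function.update ω₀ f false f = false)
    omega
  -- so `a ↔ u` without `f`, and `s` is not in that cluster
  have hau : Conn ends (Function.update ω₀ f false) a u := by
    rcases conn_update_false_cases hfa hsu with h | ⟨-, h⟩ | ⟨-, h⟩
    · exact absurd h hsu_f
    · exact h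
    · exact absurd h hsu_f
  have hsD : s ∉ cluster ends (Function.update ω₀ f false) a :=
    fun hs => hsu_f (conn_trans (conn_symm hs) hau)
  -- the cluster of `a` without `f` does not see the edges at `s`
  have hD : cluster ends (Function.update ω' f false) a =
      cluster ends (Function.update ω₀ f false) a := by
    refine cluster_eq_of_eqOn_touches (fun e' he' => ?_) rfl
    by_cases hef' : e' = f
    · rw [hef', Function.update_self, Function.update_self]
    rw [Function.update_of_ne hef', Function.update_of_ne hef']
    by_cases h0 : ω₀ e' = true
    · by_cases h' : e' ≠ f ∧ s ∈ ends e'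
      · exfalso
        obtain ⟨y, hy, z, hyz⟩ := he'
        have hs' := h'.2
        rw [hyz, Sym2.mem_iff] at hs'
        rcases hs' with hsy | hsz
        · apply hsD
          rw [hsy]
          exact hy
        · by_cases hyz' : y = z
          · apply hsD
            rw [hsz, ← hyz']
            exact hy
          · apply hsD
            rw [hsz]
            exact mem_cluster_of_adj hy (openGraph_adj.2 ⟨hyz', e',
              by rw [Function.update_of_ne hef']; exact h0, hyz⟩)
      · simp only [hω', if_neg h']
    · have h0' : ω₀ e' = false := by simpa using h0
      simp only [hω', h0', ite_self]
  have hau' : Conn ends ω' a u := by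
    have : u ∈ cluster ends (Function.update ω' f false) a := by
      rw [hD]
      exact hau
    exact conn_mono (config_le_of_imp (update_false_imp ω' f)) this
  have hsa' : Conn ends ω' s a := conn_of_openAdj ⟨f, by simp [hω', hf], hfa⟩
  have hsu' : Conn ends ω' s u := conn_trans hsa' hau'
  have hst' : ¬ Conn ends ω' s t := fun h => hst (conn_mono (config_le_of_imp hle) h)
  have h1 := hmin ω' hst' hsu' htv'
  have h2 := openCount_lt_of_le hle he (by simp [hω', hef, hse])
  omega

/-- **A minimal interface**: an off-terminal `ρ` with `u ↔ v` in `ω₀ ∨ ρ`, every edge of which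
is needed. -/
lemma exists_interface (ω₀ : Config E) (hint : Conn ends (Separated.base ends s t) u v) :
    ∃ ρ : Config E, (∀ e, ρ e = true → Separated.base ends s t e = true) ∧
      Conn ends (fun e => ω₀ e || ρ e) u v ∧
      ∀ g, ρ g = true → ¬ Conn ends (fun e => ω₀ e || Function.update ρ g false e) u v := by
  let P : Config E → Prop := fun ρ => (∀ e, ρ e = true → Separated.base ends s t e = true) ∧
    Conn ends (fun e => ω₀ e || ρ e) u v
  have hne : (Finset.univ.filter P).Nonempty := by
    refine ⟨Separated.base ends s t, ?_⟩
    simp only [Finset.mem_filter, Finset.mem_univ, true_and, P]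
    exact ⟨fun _ h => h, conn_mono (config_le_of_imp fun e h => by simp [h]) hint⟩
  obtain ⟨ρ, hρ, hmin⟩ := Finset.exists_min_image _ openCount hne
  simp only [Finset.mem_filter, Finset.mem_univ, true_and, P] at hρ
  refine ⟨ρ, hρ.1, hρ.2, ?_⟩
  intro g hg hconn
  have hmem : Function.update ρ g false ∈ Finset.univ.filter P := by
    simp only [Finset.mem_filter, Finset.mem_univ, true_and, P]
    exact ⟨fun e h => hρ.1 e (update_false_imp ρ g e h), hconn⟩
  have h1 := hmin _ hmem
  have h2 := openCount_lt_of_le (update_false_imp ρ g) hg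
    (by rw [Function.update_self] : Function.update ρ g false g = false)
  omega

/-- **A linkable and interfaced pair carries a broom.** -/
theorem exists_broom (hus : u ≠ s) (hut : u ≠ t) (hvs : v ≠ s) (hvt : v ≠ t)
    (hlink : ∃ ω : Config E, ¬ Conn ends ω s t ∧ Conn ends ω s u ∧ Conn ends ω t v)
    (hint : Conn ends (Separated.base ends s t) u v) : Nonempty (Broom ends s t u v) := by
  let P : Config E → Prop := fun ω => ¬ Conn ends ω s t ∧ Conn ends ω s u ∧ Conn ends ω t v
  obtain ⟨ω, hω⟩ := hlink
  have hne : (Finset.univ.filter P).Nonempty := by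
    refine ⟨ω, ?_⟩
    simp only [Finset.mem_filter, Finset.mem_univ, true_and, P]
    exact hω
  obtain ⟨ω₀, hω₀, hmin⟩ := Finset.exists_min_image _ openCount hne
  simp only [Finset.mem_filter, Finset.mem_univ, true_and, P] at hω₀
  obtain ⟨hst, hsu, htv⟩ := hω₀
  have hmin' : ∀ ω, ¬ Conn ends ω s t → Conn ends ω s u → Conn ends ω t v →
      openCount ω₀ ≤ openCount ω := by
    intro ω h1 h2 h3
    apply hmin
    simp only [Finset.mem_filter, Finset.mem_univ, true_and, P]
    exact ⟨h1, h2, h3⟩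
  obtain ⟨fs, hfs, hfs_mem, hfs_uniq⟩ := exists_unique_edge_at ω₀ hst hsu htv hmin' hus
  obtain ⟨ft, hft, hft_mem, hft_uniq⟩ := exists_unique_edge_at ω₀ (fun h => hst (conn_symm h))
    htv hsu (fun ω h1 h2 h3 => hmin' ω (fun h => h1 (conn_symm h)) h3 h2) hvt
  obtain ⟨ρ, hρbase, huv, hρmin⟩ := exists_interface ω₀ hint
  have hg_ex : ∃ g, ρ g = true := by
    by_contra hno
    have hρ0 : ∀ e, ρ e = false := fun e => by
      cases h : ρ e
      · rfl
      · exact absurd ⟨e, h⟩ hno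
    have heq : (fun e => ω₀ e || ρ e) = ω₀ := by
      funext e
      simp [hρ0 e]
    rw [heq] at huv
    exact hst (conn_trans hsu (conn_trans huv (conn_symm htv)))
  obtain ⟨g, hg⟩ := hg_ex
  refine ⟨⟨ω₀, ρ, fs, ft, g, hst, hsu, htv, hfs, hfs_mem, hfs_uniq, hft, hft_mem, hft_uniq, ?_,
    hg, hρmin g hg, huv, hus, hut, hvs, hvt⟩⟩
  intro e he
  have hb := hρbase e he
  rw [Separated.base, induced_eq_true_iff] at hb
  obtain ⟨-, x, hx, y, hy, hxy⟩ := hb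
  simp only [Set.mem_compl_iff, Set.mem_insert_iff, Set.mem_singleton_iff, not_or] at hx hy
  rw [hxy, Sym2.mem_iff, Sym2.mem_iff]
  constructor
  · rintro (h | h)
    · exact hx.1 h.symm
    · exact hy.1 h.symm
  · rintro (h | h)
    · exact hx.2 h.symm
    · exact hy.2 h.symm

end Exists

end Broom

/-! ### (PAIR-TP2), the (⟹) direction, and the equivalence -/

section Main

variable [Fintype V] [DecidableEq V] [Fintype E]
variable (ends : E → Sym2 V) (s t : V) {u v : V}

/-- **(PAIR-TP2), (⟹)**: for `u ≠ v` off the terminals, if `(u, v)` is linkable and `u, v` lie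
in the same component of `G − {s, t}`, some admissible weight vector makes the two-vertex status
law NOT log-supermodular on the (Z)-lattice. -/
theorem exists_not_lsm (hu : u ∉ ({s, t} : Set V)) (hv : v ∉ ({s, t} : Set V))
    (hlink : ¬ PairTP2.NotLinkable ends s t u v) (hint : v ∈ Separated.comp ends s t u) :
    ∃ p : E → ℝ, IsProbVec p ∧ ¬ ∀ x y : BoxUnionPair.ZLat V,
      BoxUnionPair.pairLaw p ends {u, v} s t x * BoxUnionPair.pairLaw p ends {u, v} s t y ≤
        BoxUnionPair.pairLaw p ends {u, v} s t (x ⊓ y) *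
          BoxUnionPair.pairLaw p ends {u, v} s t (x ⊔ y) := by
  simp only [Set.mem_insert_iff, Set.mem_singleton_iff, not_or] at hu hv
  obtain ⟨ω, hQ, hor⟩ : ∃ ω : Config E, ω ∈ (connEvent ends s t)ᶜ ∧
      ((Conn ends ω s u ∧ Conn ends ω t v) ∨ (Conn ends ω s v ∧ Conn ends ω t u)) := by
    by_contra hno
    apply hlink
    intro ω hQ
    exact ⟨fun h => hno ⟨ω, hQ, Or.inl h⟩, fun h => hno ⟨ω, hQ, Or.inr h⟩⟩
  have hst : ¬ Conn ends ω s t := hQ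
  have hint' : Conn ends (Separated.base ends s t) u v := hint
  rcases hor with ⟨hsu, htv⟩ | ⟨hsv, htu⟩
  · obtain ⟨B⟩ := Broom.exists_broom hu.1 hu.2 hv.1 hv.2 ⟨ω, hst, hsu, htv⟩ hint'
    exact ⟨B.wt (1 / 2) (1 / 2) (1 / 2),
      B.isProbVec_wt (by norm_num) (by norm_num) (by norm_num),
      B.not_lsm (by norm_num) (by norm_num) (by norm_num)⟩
  · obtain ⟨B⟩ := Broom.exists_broom hv.1 hv.2 hu.1 hu.2 ⟨ω, hst, hsv, htu⟩ (conn_symm hint')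
    refine ⟨B.wt (1 / 2) (1 / 2) (1 / 2),
      B.isProbVec_wt (by norm_num) (by norm_num) (by norm_num), ?_⟩
    rw [Finset.pair_comm]
    exact B.not_lsm (by norm_num) (by norm_num) (by norm_num)

/-- **(PAIR-TP2) in the kernel, both directions**: for `u ≠ v` off the terminals, the two-vertex
status law is log-supermodular on the (Z)-lattice for EVERY admissible weight vector iff `(u, v)`
is not linkable or `u, v` lie in different components of `G − {s, t}`. -/
theorem pairTP2_iff (hne : u ≠ v) (hu : u ∉ ({s, t} : Set V)) (hv : v ∉ ({s, t} : Set V)) :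
    (∀ p : E → ℝ, IsProbVec p → ∀ x y : BoxUnionPair.ZLat V,
      BoxUnionPair.pairLaw p ends {u, v} s t x * BoxUnionPair.pairLaw p ends {u, v} s t y ≤
        BoxUnionPair.pairLaw p ends {u, v} s t (x ⊓ y) *
          BoxUnionPair.pairLaw p ends {u, v} s t (x ⊔ y)) ↔
      (PairTP2.NotLinkable ends s t u v ∨ v ∉ Separated.comp ends s t u) := by
  constructor
  · intro h
    by_contra hno
    rw [not_or, not_not] at hno
    obtain ⟨p, hp, hviol⟩ := exists_not_lsm ends s t hu hv hno.1 hno.2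
    exact hviol (h p hp)
  · intro h p hp x y
    exact PairTP2.pairLaw_lsm_of_not_linkable_or_not_interfaced ends s t u v hne hu hv h hp x y

end Main

end PairTP2Broom

end Summit.Ventures.PercRepro2
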